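import Mathlib
import Literature.Computability.MetaComplexity.ScopeExpansion

/-!
# Steered walks and lassos in a boundaryless scope family (route ExpanderLinearGenerators)

First of three helper files for the `ℓ = 8` locality floor of item stmt-PneNP-11443
(`Summit.PneNP.PneNP.Theses.ExpanderLinearGenerators.LinearGeneratorDepthFregeHard`); the
argument is summarised in `ExpanderLinearGeneratorsThreeLassos.lean`.
Scopes `S : ι → Finset ℕ`, an index set `J` in which every point of a scope of `J` lies in a second
scope of `J` and whose scopes have `≥ 3` points (`LassoKit`: the choice functions). A bit string
`b` steers a non-backtracking walk `j, v, i₁, w₁, i₂, w₂, …` in the incidence graph (`LassoKit.st`):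
from the point `w_k` step to a second scope `i_{k+1} ∋ w_k` of `J`, then to one of two further
points of `i_{k+1}` chosen by `b k`. We record the incidence sets of truncated walks (`edgesV`,
`edgesR`) and show that two walks which re-merge — at a point reached in two different scopes, or
in a scope entered from two different points — form a LASSO (`Lasso`: an incidence set through
`(j, v)` in which every point, and every index other than `j`, has degree `0` or `≥ 2`):
`LassoKit.lassoV`, `LassoKit.lassoR`. References: folklore (Moore bound / two short cycles).
-/

namespace Summit.PneNP.PneNP.Theorems

set_option linter.dupNamespace false -- `Summit.PneNP.PneNP.…`: summit = sub-problem (D-0017)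

open Finset Literature.Computability.MetaComplexity

section Lasso

variable {ι : Type*} [DecidableEq ι] {S : ι → Finset ℕ} {J : Finset ι}

/-! ### Degrees in an incidence set -/

/-- Number of incidences of `U` at the index (row) `i`. [folklore] -/
def rowDeg (U : Finset (ι × ℕ)) (i : ι) : ℕ := (U.filter fun e => e.1 = i).card

/-- Number of incidences of `U` at the point `w`. [folklore] -/
def ptDeg (U : Finset (ι × ℕ)) (w : ℕ) : ℕ := (U.filter fun e => e.2 = w).card

/-- Two distinct incidences at a point give point degree `≥ 2`. [folklore] -/
theorem two_le_ptDeg {U : Finset (ι × ℕ)} {e e' : ι × ℕ} (he : e ∈ U) (he' : e' ∈ U)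
    (hne : e ≠ e') (h2 : e'.2 = e.2) : 2 ≤ ptDeg U e.2 := by
  unfold ptDeg
  have hsub : ({e, e'} : Finset (ι × ℕ)) ⊆ U.filter fun f => f.2 = e.2 := by
    intro f hf
    rcases Finset.mem_insert.1 hf with rfl | hf
    · simp [he]
    · rw [Finset.mem_singleton.1 hf]; simp [he', h2]
  simpa [Finset.card_pair hne] using Finset.card_le_card hsub

/-- Two distinct incidences at an index give row degree `≥ 2`. [folklore] -/
theorem two_le_rowDeg {U : Finset (ι × ℕ)} {e e' : ι × ℕ} (he : e ∈ U) (he' : e' ∈ U)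
    (hne : e ≠ e') (h1 : e'.1 = e.1) : 2 ≤ rowDeg U e.1 := by
  unfold rowDeg
  have hsub : ({e, e'} : Finset (ι × ℕ)) ⊆ U.filter fun f => f.1 = e.1 := by
    intro f hf
    rcases Finset.mem_insert.1 hf with rfl | hf
    · simp [he]
    · rw [Finset.mem_singleton.1 hf]; simp [he', h1]
  simpa [Finset.card_pair hne] using Finset.card_le_card hsub

/-- A LASSO through `(j, v)`: a set `U` of incidences of `J` containing `(j, v)` in which every
point, and every index other than `j`, has degree `0` or `≥ 2` (stated by companions: every
incidence has a second incidence of `U` at its point, and at its index unless the index is `j`).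
[folklore] -/
structure Lasso (S : ι → Finset ℕ) (J : Finset ι) (j : ι) (v : ℕ) where
  /-- the incidences of the lasso -/
  U : Finset (ι × ℕ)
  /-- the lasso starts with the incidence `(j, v)` -/
  mem : (j, v) ∈ U
  /-- it consists of incidences of `J` -/
  incid : ∀ e ∈ U, e.1 ∈ J ∧ e.2 ∈ S e.1
  /-- every index other than `j` is entered and left -/
  row : ∀ e ∈ U, e.1 ≠ j → ∃ e' ∈ U, e' ≠ e ∧ e'.1 = e.1
  /-- every point is entered and left -/
  pt : ∀ e ∈ U, ∃ e' ∈ U, e' ≠ e ∧ e'.2 = e.2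

/-! ### Steered non-backtracking walks -/

variable (S J) in
/-- Choice data for walks inside a boundaryless family `J` with scopes of `≥ 3` points: a second
scope `nxt i w ∈ J` through each point `w ∈ S i`, and two distinct exit points
`ex true i w ≠ ex false i w` of `S i` other than `w`. [folklore] -/
structure LassoKit where
  /-- a second scope of `J` through the point -/
  nxt : ι → ℕ → ι
  /-- two exits of a scope avoiding the entry point -/
  ex : Bool → ι → ℕ → ℕ
  nxt_mem : ∀ i ∈ J, ∀ w ∈ S i, nxt i w ∈ J
  nxt_ne : ∀ i ∈ J, ∀ w ∈ S i, nxt i w ≠ i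
  mem_nxt : ∀ i ∈ J, ∀ w ∈ S i, w ∈ S (nxt i w)
  ex_mem : ∀ c, ∀ i ∈ J, ∀ w, ex c i w ∈ S i
  ex_ne : ∀ c, ∀ i ∈ J, ∀ w, ex c i w ≠ w
  ex_inj : ∀ i ∈ J, ∀ w, ex true i w ≠ ex false i w

/-- The choice data exist when `J` is boundaryless and its scopes have `≥ 3` points. [folklore] -/
theorem nonempty_lassoKit (hcl : ∀ i ∈ J, ∀ w ∈ S i, ∃ i' ∈ J, i' ≠ i ∧ w ∈ S i')
    (h3 : ∀ i ∈ J, 3 ≤ (S i).card) : Nonempty (LassoKit S J) := by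
  classical
  have hn : ∀ i w, ∃ i', (i ∈ J ∧ w ∈ S i) → (i' ∈ J ∧ i' ≠ i ∧ w ∈ S i') := by
    intro i w
    by_cases h : i ∈ J ∧ w ∈ S i
    · obtain ⟨i', hi', hne, hw⟩ := hcl i h.1 w h.2
      exact ⟨i', fun _ => ⟨hi', hne, hw⟩⟩
    · exact ⟨i, fun h' => absurd h' h⟩
  choose nxt hnxt using hn
  have he : ∀ i w, ∃ p : ℕ × ℕ, i ∈ J → (p.1 ∈ S i ∧ p.2 ∈ S i ∧ p.1 ≠ w ∧ p.2 ≠ w ∧ p.1 ≠ p.2) := by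
    intro i w
    by_cases hi : i ∈ J
    · have h2 : 1 < ((S i).erase w).card := by
        have := Finset.pred_card_le_card_erase (s := S i) (a := w)
        have := h3 i hi
        omega
      obtain ⟨a, ha, b, hb, hab⟩ := Finset.one_lt_card.1 h2
      exact ⟨(a, b), fun _ => ⟨Finset.mem_of_mem_erase ha, Finset.mem_of_mem_erase hb,
        Finset.ne_of_mem_erase ha, Finset.ne_of_mem_erase hb, hab⟩⟩
    · exact ⟨(0, 0), fun h => absurd h hi⟩
  choose ex hex using he
  refine ⟨⟨nxt, fun c i w => if c then (ex i w).1 else (ex i w).2, fun i hi w hw => (hnxt i w ⟨hi, hw⟩).1,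
    fun i hi w hw => (hnxt i w ⟨hi, hw⟩).2.1, fun i hi w hw => (hnxt i w ⟨hi, hw⟩).2.2, ?_, ?_, ?_⟩⟩
  · intro c i hi w
    cases c
    · simpa using (hex i w hi).2.1
    · simpa using (hex i w hi).1
  · intro c i hi w
    cases c
    · simpa using (hex i w hi).2.2.2.1
    · simpa using (hex i w hi).2.2.1
  · intro i hi w
    simpa using (hex i w hi).2.2.2.2

namespace LassoKit

variable (K : LassoKit S J)

/-- The walk steered by the bits `b`: `st b k = (i_k, w_k)` with `(i₀, w₀) = (j, v)`,
`i_{k+1} = nxt i_k w_k` and `w_{k+1} = ex (b k) i_{k+1} w_k`. [folklore] -/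
def st (j : ι) (v : ℕ) (b : ℕ → Bool) : ℕ → ι × ℕ
  | 0 => (j, v)
  | k + 1 => (K.nxt (st j v b k).1 (st j v b k).2,
      K.ex (b k) (K.nxt (st j v b k).1 (st j v b k).2) (st j v b k).2)

omit [DecidableEq ι] in
/-- One step of the walk (definitional unfolding). [folklore] -/
theorem st_succ (j : ι) (v : ℕ) (b : ℕ → Bool) (k : ℕ) :
    K.st j v b (k + 1) = (K.nxt (K.st j v b k).1 (K.st j v b k).2,
      K.ex (b k) (K.nxt (K.st j v b k).1 (K.st j v b k).2) (K.st j v b k).2) := rfl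

variable {j : ι} {v : ℕ}

omit [DecidableEq ι] in
/-- Every state of the walk is an incidence of `J`. [folklore] -/
theorem st_mem (hj : j ∈ J) (hv : v ∈ S j) (b : ℕ → Bool) :
    ∀ k, (K.st j v b k).1 ∈ J ∧ (K.st j v b k).2 ∈ S (K.st j v b k).1
  | 0 => ⟨hj, hv⟩
  | k + 1 => by
    obtain ⟨h1, h2⟩ := st_mem hj hv b k
    have hn := K.nxt_mem _ h1 _ h2
    exact ⟨hn, K.ex_mem _ _ hn _⟩

omit [DecidableEq ι] in
/-- The index `i_k` lies in `J`. [folklore] -/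
theorem fst_mem (hj : j ∈ J) (hv : v ∈ S j) (b : ℕ → Bool) (k : ℕ) : (K.st j v b k).1 ∈ J :=
  (K.st_mem hj hv b k).1
omit [DecidableEq ι] in
/-- The entry incidence: `w_k ∈ S i_{k+1}`. [folklore] -/
theorem snd_mem_succ (hj : j ∈ J) (hv : v ∈ S j) (b : ℕ → Bool) (k : ℕ) :
    (K.st j v b k).2 ∈ S (K.st j v b (k + 1)).1 :=
  K.mem_nxt _ (K.st_mem hj hv b k).1 _ (K.st_mem hj hv b k).2

omit [DecidableEq ι] in
/-- Non-backtracking at indices: `i_{k+1} ≠ i_k`. [folklore] -/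
theorem fst_succ_ne (hj : j ∈ J) (hv : v ∈ S j) (b : ℕ → Bool) (k : ℕ) :
    (K.st j v b (k + 1)).1 ≠ (K.st j v b k).1 :=
  K.nxt_ne _ (K.st_mem hj hv b k).1 _ (K.st_mem hj hv b k).2

omit [DecidableEq ι] in
/-- Non-backtracking at points: `w_{k+1} ≠ w_k`. [folklore] -/
theorem snd_succ_ne (hj : j ∈ J) (hv : v ∈ S j) (b : ℕ → Bool) (k : ℕ) :
    (K.st j v b (k + 1)).2 ≠ (K.st j v b k).2 := by
  obtain ⟨h1, h2⟩ := K.st_mem hj hv b k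
  exact K.ex_ne _ _ (K.nxt_mem _ h1 _ h2) _

omit [DecidableEq ι] in
/-- Walks steered by bit strings agreeing below `k` agree up to time `k`. [folklore] -/
theorem st_eq_of_agree {b b' : ℕ → Bool} {k : ℕ} (h : ∀ l < k, b l = b' l) :
    ∀ l ≤ k, K.st j v b l = K.st j v b' l
  | 0, _ => rfl
  | l + 1, hl => by
    have ih := st_eq_of_agree h l (by omega)
    rw [st_succ, st_succ, ih, h l (by omega)]

omit [DecidableEq ι] in
/-- After the first differing bit the two walks sit in the same scope at different points.
[folklore] -/
theorem split_step (hj : j ∈ J) (hv : v ∈ S j) {b b' : ℕ → Bool} {k : ℕ}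
    (h : ∀ l < k, b l = b' l) (hk : b k ≠ b' k) :
    (K.st j v b (k + 1)).1 = (K.st j v b' (k + 1)).1 ∧
      (K.st j v b (k + 1)).2 ≠ (K.st j v b' (k + 1)).2 := by
  have he : K.st j v b k = K.st j v b' k := K.st_eq_of_agree h k le_rfl
  have hJ : (K.nxt (K.st j v b k).1 (K.st j v b k).2) ∈ J :=
    K.nxt_mem _ (K.fst_mem hj hv b k) _ (K.st_mem hj hv b k).2
  have hinj := K.ex_inj _ hJ (K.st j v b k).2
  rw [st_succ, st_succ, ← he]
  refine ⟨rfl, ?_⟩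
  dsimp only
  revert hk hinj
  cases b k <;> cases b' k <;> intro hk hinj <;> first | exact absurd rfl hk | exact hinj |
    exact fun h' => hinj h'.symm

/-! ### Incidence sets of truncated walks -/

/-- Incidences of the walk truncated at the POINT `w_n`: own incidences `(i_k, w_k)`, `k ≤ n`, and
entry incidences `(i_{k+1}, w_k)`, `k < n`. [folklore] -/
def edgesV (j : ι) (v : ℕ) (b : ℕ → Bool) (n : ℕ) : Finset (ι × ℕ) :=
  (range (n + 1)).image (fun k => K.st j v b k) ∪
    (range n).image (fun k => ((K.st j v b (k + 1)).1, (K.st j v b k).2))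

/-- Incidences of the walk truncated at the INDEX `i_n`: own incidences `(i_k, w_k)`, `k < n`, and
entry incidences `(i_{k+1}, w_k)`, `k < n`. [folklore] -/
def edgesR (j : ι) (v : ℕ) (b : ℕ → Bool) (n : ℕ) : Finset (ι × ℕ) :=
  (range n).image (fun k => K.st j v b k) ∪
    (range n).image (fun k => ((K.st j v b (k + 1)).1, (K.st j v b k).2))

/-- Own incidences belong to the point-truncated walk. [folklore] -/
theorem own_mem_edgesV {b : ℕ → Bool} {n k : ℕ} (hk : k ≤ n) :
    K.st j v b k ∈ K.edgesV j v b n :=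
  Finset.mem_union_left _ (Finset.mem_image.2 ⟨k, Finset.mem_range.2 (by omega), rfl⟩)

/-- Entry incidences belong to the point-truncated walk. [folklore] -/
theorem ent_mem_edgesV {b : ℕ → Bool} {n k : ℕ} (hk : k < n) :
    ((K.st j v b (k + 1)).1, (K.st j v b k).2) ∈ K.edgesV j v b n :=
  Finset.mem_union_right _ (Finset.mem_image.2 ⟨k, Finset.mem_range.2 hk, rfl⟩)

/-- Own incidences belong to the index-truncated walk. [folklore] -/
theorem own_mem_edgesR {b : ℕ → Bool} {n k : ℕ} (hk : k < n) :
    K.st j v b k ∈ K.edgesR j v b n :=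
  Finset.mem_union_left _ (Finset.mem_image.2 ⟨k, Finset.mem_range.2 hk, rfl⟩)

/-- Entry incidences belong to the index-truncated walk. [folklore] -/
theorem ent_mem_edgesR {b : ℕ → Bool} {n k : ℕ} (hk : k < n) :
    ((K.st j v b (k + 1)).1, (K.st j v b k).2) ∈ K.edgesR j v b n :=
  Finset.mem_union_right _ (Finset.mem_image.2 ⟨k, Finset.mem_range.2 hk, rfl⟩)

/-- Membership in the point-truncated incidence set. [folklore] -/
theorem mem_edgesV {b : ℕ → Bool} {n : ℕ} {e : ι × ℕ} :
    e ∈ K.edgesV j v b n ↔ (∃ k ≤ n, e = K.st j v b k) ∨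
      ∃ k < n, e = ((K.st j v b (k + 1)).1, (K.st j v b k).2) := by
  simp only [edgesV, Finset.mem_union, Finset.mem_image, Finset.mem_range]
  constructor <;> rintro (⟨k, hk, rfl⟩ | ⟨k, hk, rfl⟩) <;>
    first | exact Or.inl ⟨k, by omega, rfl⟩ | exact Or.inr ⟨k, by omega, rfl⟩

/-- Membership in the index-truncated incidence set. [folklore] -/
theorem mem_edgesR {b : ℕ → Bool} {n : ℕ} {e : ι × ℕ} :
    e ∈ K.edgesR j v b n ↔ (∃ k < n, e = K.st j v b k) ∨
      ∃ k < n, e = ((K.st j v b (k + 1)).1, (K.st j v b k).2) := by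
  simp only [edgesR, Finset.mem_union, Finset.mem_image, Finset.mem_range]
  constructor <;> rintro (⟨k, hk, rfl⟩ | ⟨k, hk, rfl⟩) <;>
    first | exact Or.inl ⟨k, by omega, rfl⟩ | exact Or.inr ⟨k, by omega, rfl⟩

omit [DecidableEq ι] in
/-- The own and entry incidences at time `k` differ (they sit at different indices). [folklore] -/
theorem own_ne_ent (hj : j ∈ J) (hv : v ∈ S j) (b : ℕ → Bool) (k : ℕ) :
    K.st j v b k ≠ ((K.st j v b (k + 1)).1, (K.st j v b k).2) := by
  intro h
  have h1 : (K.st j v b k).1 = (K.st j v b (k + 1)).1 := by rw [h]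
  exact K.fst_succ_ne hj hv b k h1.symm

omit [DecidableEq ι] in
/-- The own incidence at time `k + 1` and the entry incidence at time `k` differ (they sit at
different points). [folklore] -/
theorem own_succ_ne_ent (hj : j ∈ J) (hv : v ∈ S j) (b : ℕ → Bool) (k : ℕ) :
    K.st j v b (k + 1) ≠ ((K.st j v b (k + 1)).1, (K.st j v b k).2) := by
  intro h
  have h2 : (K.st j v b (k + 1)).2 = (K.st j v b k).2 := by rw [h]
  exact K.snd_succ_ne hj hv b k h2

/-! ### Two walks with a common end yield a lasso -/

/-- Row companions inside a point-truncated walk. [folklore] -/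
theorem row_companion_edgesV (hj : j ∈ J) (hv : v ∈ S j) {b : ℕ → Bool} {n : ℕ} {e : ι × ℕ}
    (he : e ∈ K.edgesV j v b n) (hne : e.1 ≠ j) :
    ∃ e' ∈ K.edgesV j v b n, e' ≠ e ∧ e'.1 = e.1 := by
  rcases (K.mem_edgesV).1 he with ⟨k, hk, rfl⟩ | ⟨k, hk, rfl⟩
  · cases k with
    | zero => exact absurd rfl hne
    | succ k =>
      exact ⟨_, K.ent_mem_edgesV (by omega), (K.own_succ_ne_ent hj hv b k).symm, rfl⟩
  · exact ⟨_, K.own_mem_edgesV (by omega : k + 1 ≤ n), K.own_succ_ne_ent hj hv b k, rfl⟩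

/-- Point companions inside a point-truncated walk, except at the end point. [folklore] -/
theorem pt_companion_edgesV (hj : j ∈ J) (hv : v ∈ S j) {b : ℕ → Bool} {n : ℕ} {e : ι × ℕ}
    (he : e ∈ K.edgesV j v b n) :
    (∃ e' ∈ K.edgesV j v b n, e' ≠ e ∧ e'.2 = e.2) ∨ e = K.st j v b n := by
  rcases (K.mem_edgesV).1 he with ⟨k, hk, rfl⟩ | ⟨k, hk, rfl⟩
  · by_cases hkn : k = n
    · exact Or.inr (by rw [hkn])
    · exact Or.inl ⟨_, K.ent_mem_edgesV (by omega : k < n), (K.own_ne_ent hj hv b k).symm, rfl⟩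
  · exact Or.inl ⟨_, K.own_mem_edgesV (by omega : k ≤ n), K.own_ne_ent hj hv b k, rfl⟩

/-- Row companions inside an index-truncated walk, except at the end index. [folklore] -/
theorem row_companion_edgesR (hj : j ∈ J) (hv : v ∈ S j) {b : ℕ → Bool} {m : ℕ} {e : ι × ℕ}
    (he : e ∈ K.edgesR j v b (m + 1)) (hne : e.1 ≠ j) :
    (∃ e' ∈ K.edgesR j v b (m + 1), e' ≠ e ∧ e'.1 = e.1) ∨
      e = ((K.st j v b (m + 1)).1, (K.st j v b m).2) := by
  rcases (K.mem_edgesR).1 he with ⟨k, hk, rfl⟩ | ⟨k, hk, rfl⟩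
  · cases k with
    | zero => exact absurd rfl hne
    | succ k =>
      exact Or.inl ⟨_, K.ent_mem_edgesR (by omega), (K.own_succ_ne_ent hj hv b k).symm, rfl⟩
  · by_cases hkm : k = m
    · exact Or.inr (by rw [hkm])
    · exact Or.inl ⟨_, K.own_mem_edgesR (by omega : k + 1 < m + 1), K.own_succ_ne_ent hj hv b k,
        rfl⟩

/-- Point companions inside an index-truncated walk. [folklore] -/
theorem pt_companion_edgesR (hj : j ∈ J) (hv : v ∈ S j) {b : ℕ → Bool} {n : ℕ} {e : ι × ℕ}
    (he : e ∈ K.edgesR j v b n) : ∃ e' ∈ K.edgesR j v b n, e' ≠ e ∧ e'.2 = e.2 := by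
  rcases (K.mem_edgesR).1 he with ⟨k, hk, rfl⟩ | ⟨k, hk, rfl⟩
  · exact ⟨_, K.ent_mem_edgesR hk, (K.own_ne_ent hj hv b k).symm, rfl⟩
  · exact ⟨_, K.own_mem_edgesR hk, K.own_ne_ent hj hv b k, rfl⟩

/-- Incidences of truncated walks are incidences of `J`. [folklore] -/
theorem incid_of_mem_edgesV (hj : j ∈ J) (hv : v ∈ S j) {b : ℕ → Bool} {n : ℕ} {e : ι × ℕ}
    (he : e ∈ K.edgesV j v b n) : e.1 ∈ J ∧ e.2 ∈ S e.1 := by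
  rcases (K.mem_edgesV).1 he with ⟨k, -, rfl⟩ | ⟨k, -, rfl⟩
  · exact K.st_mem hj hv b k
  · exact ⟨K.fst_mem hj hv b (k + 1), K.snd_mem_succ hj hv b k⟩

/-- Incidences of truncated walks are incidences of `J`. [folklore] -/
theorem incid_of_mem_edgesR (hj : j ∈ J) (hv : v ∈ S j) {b : ℕ → Bool} {n : ℕ} {e : ι × ℕ}
    (he : e ∈ K.edgesR j v b n) : e.1 ∈ J ∧ e.2 ∈ S e.1 := by
  rcases (K.mem_edgesR).1 he with ⟨k, -, rfl⟩ | ⟨k, -, rfl⟩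
  · exact K.st_mem hj hv b k
  · exact ⟨K.fst_mem hj hv b (k + 1), K.snd_mem_succ hj hv b k⟩

/-- **Merging at a point.** Two walks through `(j, v)` that occupy the same point at time `n` in
different scopes form a lasso (point-truncated at `n`). [folklore] -/
def lassoV (hj : j ∈ J) (hv : v ∈ S j) {b b' : ℕ → Bool} {n : ℕ}
    (hpt : (K.st j v b n).2 = (K.st j v b' n).2) (hrow : (K.st j v b n).1 ≠ (K.st j v b' n).1) :
    Lasso S J j v where
  U := K.edgesV j v b n ∪ K.edgesV j v b' n
  mem := Finset.mem_union_left _ (K.own_mem_edgesV (Nat.zero_le n))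
  incid e he := by
    rcases Finset.mem_union.1 he with he | he
    · exact K.incid_of_mem_edgesV hj hv he
    · exact K.incid_of_mem_edgesV hj hv he
  row e he hne := by
    rcases Finset.mem_union.1 he with he | he
    · obtain ⟨e', he', h1, h2⟩ := K.row_companion_edgesV hj hv he hne
      exact ⟨e', Finset.mem_union_left _ he', h1, h2⟩
    · obtain ⟨e', he', h1, h2⟩ := K.row_companion_edgesV hj hv he hne
      exact ⟨e', Finset.mem_union_right _ he', h1, h2⟩
  pt e he := by
    have hne : K.st j v b n ≠ K.st j v b' n := fun h => hrow (by rw [h])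
    rcases Finset.mem_union.1 he with he | he
    · rcases K.pt_companion_edgesV hj hv he with ⟨e', he', h1, h2⟩ | rfl
      · exact ⟨e', Finset.mem_union_left _ he', h1, h2⟩
      · exact ⟨_, Finset.mem_union_right _ (K.own_mem_edgesV le_rfl), hne.symm, hpt.symm⟩
    · rcases K.pt_companion_edgesV hj hv he with ⟨e', he', h1, h2⟩ | rfl
      · exact ⟨e', Finset.mem_union_right _ he', h1, h2⟩
      · exact ⟨_, Finset.mem_union_left _ (K.own_mem_edgesV le_rfl), hne, hpt⟩

/-- **Merging at an index.** Two walks through `(j, v)` that occupy the same scope at time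
`m + 1`, entered from different points, form a lasso (index-truncated at `m + 1`). [folklore] -/
def lassoR (hj : j ∈ J) (hv : v ∈ S j) {b b' : ℕ → Bool} {m : ℕ}
    (hrow : (K.st j v b (m + 1)).1 = (K.st j v b' (m + 1)).1)
    (hpt : (K.st j v b m).2 ≠ (K.st j v b' m).2) :
    Lasso S J j v where
  U := K.edgesR j v b (m + 1) ∪ K.edgesR j v b' (m + 1)
  mem := Finset.mem_union_left _ (K.own_mem_edgesR (Nat.succ_pos m))
  incid e he := by
    rcases Finset.mem_union.1 he with he | he
    · exact K.incid_of_mem_edgesR hj hv he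
    · exact K.incid_of_mem_edgesR hj hv he
  row e he hne := by
    have hne' : ((K.st j v b (m + 1)).1, (K.st j v b m).2) ≠
        ((K.st j v b' (m + 1)).1, (K.st j v b' m).2) := fun h => hpt (by
      have := congrArg Prod.snd h; exact this)
    rcases Finset.mem_union.1 he with he | he
    · rcases K.row_companion_edgesR hj hv he hne with ⟨e', he', h1, h2⟩ | rfl
      · exact ⟨e', Finset.mem_union_left _ he', h1, h2⟩
      · exact ⟨_, Finset.mem_union_right _ (K.ent_mem_edgesR (Nat.lt_succ_self m)), hne'.symm,
          hrow.symm⟩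
    · rcases K.row_companion_edgesR hj hv he hne with ⟨e', he', h1, h2⟩ | rfl
      · exact ⟨e', Finset.mem_union_right _ he', h1, h2⟩
      · exact ⟨_, Finset.mem_union_left _ (K.ent_mem_edgesR (Nat.lt_succ_self m)), hne', hrow⟩
  pt e he := by
    rcases Finset.mem_union.1 he with he | he
    · obtain ⟨e', he', h1, h2⟩ := K.pt_companion_edgesR hj hv he
      exact ⟨e', Finset.mem_union_left _ he', h1, h2⟩
    · obtain ⟨e', he', h1, h2⟩ := K.pt_companion_edgesR hj hv he
      exact ⟨e', Finset.mem_union_right _ he', h1, h2⟩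

end LassoKit

end Lasso

end Summit.PneNP.PneNP.Theorems
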